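import Mathlib
import Summits.Ventures.PercRepro2.Defs
import Summits.Ventures.PercRepro2.Independence
import Summits.Ventures.PercRepro2.Harris
import Summits.Ventures.PercRepro2.Graph
import Summits.Ventures.PercRepro2.Exploration
import Summits.Ventures.PercRepro2.Events

/-!
# The cluster of a seed set, explored like one cluster (blind cell PercRepro2, typer-1)

For a seed set `S` of vertices, `C(S) = ⋃_{s ∈ S} C(s)` (`clusterSet`).  Everything that
`Graph.lean` / `Exploration.lean` say about one cluster `C(v)` holds for `C(S)` with the same
proofs (the lead's 17:09Z note: "explored exactly like one cluster"):

* `clusterSet_closed`: `C(S)` is closed under open adjacency;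
* `dependsOn_clusterSetEvent`: `{C(S) = W}` is determined by the edges touching `W`
  (domain Markov), hence `prob_clusterSetEvent_inter_eq_mul` — anything determined by the edges
  not touching `W` is independent of `{C(S) = W}` — and `prob_clusterSetEvent_inter_connEvent`:
  `P(C(S) = W, u ↔ w) = P(C(S) = W) · P_{G∖W}(u ↔ w)` for `u ∉ W`;
* `memClusterSetEvent ends S x = {x ∈ C(S)} = hitEvent ends x S` (so it is increasing, and
  monotone in the seed set: `prob_memClusterSetEvent_mono_seed`);
* the cancellation `memClusterSetEvent_inter_eq_union`:
  `{b ∈ C(S), y ∈ C(S)} = {y ∈ C(S), y ↔ b} ⊔ {y, b ∈ C(S), y ↮ b}`, i.e.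
  `P(b ∈ C(S), y ∈ C(S)) − P(y ↔ b, y ∈ C(S)) = P(y | b)` (`prob_memClusterSet_sub_eq_split`).
-/

namespace Summit.Ventures.PercRepro2

section ClusterSet

variable {V : Type*} {E : Type*}

/-- The cluster of the seed set `S`: `C(S) = ⋃_{s ∈ S} C(s)`. -/
def clusterSet (ends : E → Sym2 V) (ω : Config E) (S : Finset V) : Set V :=
  {x | ∃ s ∈ S, Conn ends ω s x}

/-- Membership in `C(S)`. -/
@[simp] lemma mem_clusterSet {ends : E → Sym2 V} {ω : Config E} {S : Finset V} {x : V} :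
    x ∈ clusterSet ends ω S ↔ ∃ s ∈ S, Conn ends ω s x := Iff.rfl

/-- `C(S) = ⋃_{s ∈ S} C(s)`. -/
lemma clusterSet_eq_biUnion (ends : E → Sym2 V) (ω : Config E) (S : Finset V) :
    clusterSet ends ω S = ⋃ s ∈ S, cluster ends ω s := by
  ext x
  simp

/-- `C({v}) = C(v)`. -/
lemma clusterSet_singleton (ends : E → Sym2 V) (ω : Config E) (v : V) :
    clusterSet ends ω {v} = cluster ends ω v := by
  ext x
  simp

/-- The seeds lie in their cluster. -/
lemma seed_mem_clusterSet (ends : E → Sym2 V) (ω : Config E) {S : Finset V} {s : V}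
    (hs : s ∈ S) : s ∈ clusterSet ends ω S :=
  ⟨s, hs, conn_refl ends ω s⟩

/-- `C(S)` is closed under connection. -/
lemma mem_clusterSet_of_conn {ends : E → Sym2 V} {ω : Config E} {S : Finset V} {x y : V}
    (hx : x ∈ clusterSet ends ω S) (h : Conn ends ω x y) : y ∈ clusterSet ends ω S := by
  obtain ⟨s, hs, hsx⟩ := hx
  exact ⟨s, hs, conn_trans hsx h⟩

/-- `C(S)` is closed under open adjacency. -/
lemma clusterSet_closed {ends : E → Sym2 V} {ω : Config E} {S : Finset V} {x y : V}
    (hx : x ∈ clusterSet ends ω S) (hxy : (openGraph ends ω).Adj x y) :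
    y ∈ clusterSet ends ω S :=
  mem_clusterSet_of_conn hx (SimpleGraph.Adj.reachable hxy)

/-- `C(S)` is monotone in the seed set. -/
lemma clusterSet_mono_seed (ends : E → Sym2 V) (ω : Config E) {S S' : Finset V} (h : S ⊆ S') :
    clusterSet ends ω S ⊆ clusterSet ends ω S' :=
  fun _ ⟨s, hs, hsx⟩ => ⟨s, h hs, hsx⟩

/-- `C(S)` is monotone in the configuration. -/
lemma clusterSet_mono {ends : E → Sym2 V} {ω ω' : Config E} (h : ω ≤ ω') (S : Finset V) :
    clusterSet ends ω S ⊆ clusterSet ends ω' S :=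
  fun _ ⟨s, hs, hsx⟩ => ⟨s, hs, conn_mono h hsx⟩

/-- The event `{C(S) = W}`. -/
def clusterSetEvent (ends : E → Sym2 V) (S : Finset V) (W : Set V) : Set (Config E) :=
  {ω | clusterSet ends ω S = W}

/-- Membership in `clusterSetEvent`. -/
@[simp] lemma mem_clusterSetEvent {ends : E → Sym2 V} {S : Finset V} {W : Set V} {ω : Config E} :
    ω ∈ clusterSetEvent ends S W ↔ clusterSet ends ω S = W := Iff.rfl

/-- The event `{x ∈ C(S)}`. -/
def memClusterSetEvent (ends : E → Sym2 V) (S : Finset V) (x : V) : Set (Config E) :=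
  {ω | x ∈ clusterSet ends ω S}

/-- `{x ∈ C(S)} = {x ↔ S}`. -/
lemma memClusterSetEvent_eq_hitEvent (ends : E → Sym2 V) (S : Finset V) (x : V) :
    memClusterSetEvent ends S x = hitEvent ends x S := by
  ext ω
  simp only [memClusterSetEvent, Set.mem_setOf_eq, mem_clusterSet, mem_hitEvent]
  exact ⟨fun ⟨s, hs, h⟩ => ⟨s, hs, conn_symm h⟩, fun ⟨s, hs, h⟩ => ⟨s, hs, conn_symm h⟩⟩

/-- `{x ∈ C(S)}` is increasing. -/
lemma isUpperSet_memClusterSetEvent (ends : E → Sym2 V) (S : Finset V) (x : V) :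
    IsUpperSet (memClusterSetEvent ends S x) := by
  rw [memClusterSetEvent_eq_hitEvent]
  exact isUpperSet_hitEvent ends x S

/-- `{x ∈ C(S)} ⊆ {x ∈ C(S')}` for `S ⊆ S'`. -/
lemma memClusterSetEvent_mono_seed (ends : E → Sym2 V) {S S' : Finset V} (h : S ⊆ S') (x : V) :
    memClusterSetEvent ends S x ⊆ memClusterSetEvent ends S' x :=
  fun ω hω => clusterSet_mono_seed ends ω h hω

end ClusterSet

/-! ## Domain Markov property for `C(S)` -/

section Markov

variable {V : Type*} {E : Type*}

/-- If `ω` and `ω'` agree on the edges touching `W` and `C_ω(S) = W`, then `C_{ω'}(S) = W`. -/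
lemma clusterSet_eq_of_eqOn_touches {ends : E → Sym2 V} {ω ω' : Config E} {S : Finset V}
    {W : Set V} (h : ∀ e ∈ touches ends W, ω e = ω' e) (hW : clusterSet ends ω S = W) :
    clusterSet ends ω' S = W := by
  apply Set.Subset.antisymm
  · rintro u ⟨s, hs, hsu⟩
    have hsW : s ∈ W := hW ▸ seed_mem_clusterSet ends ω hs
    refine mem_of_conn_of_closed (ends := ends) (ω := ω') ?_ hsW hsu
    intro x hx y hxy
    obtain ⟨_, e, he, hends⟩ := openGraph_adj.1 hxy
    have he' : ω e = true := by rw [h e ⟨x, hx, y, hends⟩]; exact he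
    rw [← hW] at hx ⊢
    exact mem_clusterSet_of_conn hx (conn_of_openAdj ⟨e, he', hends⟩)
  · rintro u hu
    rw [← hW] at hu
    obtain ⟨s, hs, hsu⟩ := hu
    have hsW : s ∈ W := hW ▸ seed_mem_clusterSet ends ω hs
    have key : u ∈ {x | x ∈ W ∧ Conn ends ω' s x} := by
      refine mem_of_conn_of_closed (ends := ends) (ω := ω) ?_ ⟨hsW, conn_refl ends ω' s⟩ hsu
      rintro x ⟨hxW, hxc⟩ y hxy
      obtain ⟨_, e, he, hends⟩ := openGraph_adj.1 hxy
      have he' : ω' e = true := by rw [← h e ⟨x, hxW, y, hends⟩]; exact he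
      refine ⟨?_, conn_trans hxc (conn_of_openAdj ⟨e, he', hends⟩)⟩
      rw [← hW] at hxW ⊢
      exact mem_clusterSet_of_conn hxW (conn_of_openAdj ⟨e, he, hends⟩)
    exact ⟨s, hs, key.2⟩

/-- **Domain Markov property for a seed set**: `{C(S) = W}` is determined by the edges touching
`W`. -/
theorem dependsOn_clusterSetEvent (ends : E → Sym2 V) (S : Finset V) (W : Set V) :
    DependsOn (· ∈ clusterSetEvent ends S W) (touches ends W) := by
  intro ω ω' h
  exact propext ⟨clusterSet_eq_of_eqOn_touches h,
    clusterSet_eq_of_eqOn_touches fun e he => (h e he).symm⟩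

variable [Fintype E] [DecidableEq E] {R : Type*} [CommRing R]

/-- **Domain Markov property for a seed set, probabilistic form**: an event determined by edges
not touching `W` is independent of `{C(S) = W}`. -/
theorem prob_clusterSetEvent_inter_eq_mul (p : E → R) (ends : E → Sym2 V) (S : Finset V)
    (W : Set V) {A : Set (Config E)} {F : Set E} (hA : DependsOn (· ∈ A) F)
    (hF : Disjoint (touches ends W) F) :
    prob p (clusterSetEvent ends S W ∩ A) = prob p (clusterSetEvent ends S W) * prob p A :=
  prob_inter_eq_mul_of_dependsOn p hF (dependsOn_clusterSetEvent ends S W) hA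

omit [Fintype E] [DecidableEq E] in
/-- On `{C(S) = W}`, for `u ∉ W` the connections of `u` only use edges not touching `W`. -/
lemma conn_restrict_iff_of_clusterSet_eq {ends : E → Sym2 V} {ω : Config E} {S : Finset V}
    {W : Set V} [DecidablePred (· ∈ (touches ends W)ᶜ)] (hW : clusterSet ends ω S = W) {u w : V}
    (hu : u ∉ W) : Conn ends (restrict (touches ends W)ᶜ ω) u w ↔ Conn ends ω u w := by
  constructor
  · exact conn_mono (restrict_le _ ω)
  · intro h
    have key : w ∈ {x | x ∉ W ∧ Conn ends (restrict (touches ends W)ᶜ ω) u x} := by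
      refine mem_of_conn_of_closed (ends := ends) (ω := ω) ?_ ⟨hu, conn_refl _ _ _⟩ h
      rintro x ⟨hxW, hxc⟩ y hxy
      obtain ⟨_, e, he, hends⟩ := openGraph_adj.1 hxy
      have hyW : y ∉ W := by
        intro hy
        apply hxW
        rw [← hW] at hy ⊢
        exact mem_clusterSet_of_conn hy (conn_of_openAdj (OpenAdj.symm ⟨e, he, hends⟩))
      have hnt : e ∉ touches ends W := by
        rintro ⟨x', hx', y', hends'⟩
        rw [hends, Sym2.eq_iff] at hends'
        rcases hends' with ⟨rfl, _⟩ | ⟨_, rfl⟩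
        · exact hxW hx'
        · exact hyW hx'
      have he' : restrict (touches ends W)ᶜ ω e = true := restrict_eq_true_iff.2 ⟨he, hnt⟩
      exact ⟨hyW, conn_trans hxc (conn_of_openAdj ⟨e, he', hends⟩)⟩
    exact key.2

/-- **Spatial Markov property for connections after exploring `C(S)`**: for `u ∉ W`,
`P(C(S) = W, u ↔ w) = P(C(S) = W) · P(u ↔ w in the graph with the edges touching W removed)`. -/
theorem prob_clusterSetEvent_inter_connEvent (p : E → R) (ends : E → Sym2 V) (S : Finset V)
    (W : Set V) [DecidablePred (· ∈ (touches ends W)ᶜ)] {u w : V} (hu : u ∉ W) :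
    prob p (clusterSetEvent ends S W ∩ connEvent ends u w) =
      prob p (clusterSetEvent ends S W) *
        prob p {ω | Conn ends (restrict (touches ends W)ᶜ ω) u w} := by
  have hset : clusterSetEvent ends S W ∩ connEvent ends u w =
      clusterSetEvent ends S W ∩ {ω | Conn ends (restrict (touches ends W)ᶜ ω) u w} := by
    ext ω
    simp only [Set.mem_inter_iff, mem_clusterSetEvent, mem_connEvent, Set.mem_setOf_eq]
    constructor
    · rintro ⟨hW, h⟩
      exact ⟨hW, (conn_restrict_iff_of_clusterSet_eq hW hu).2 h⟩
    · rintro ⟨hW, h⟩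
      exact ⟨hW, (conn_restrict_iff_of_clusterSet_eq hW hu).1 h⟩
  rw [hset]
  exact prob_clusterSetEvent_inter_eq_mul p ends S W
    (dependsOn_restrict (touches ends W)ᶜ fun ω' => Conn ends ω' u w) disjoint_compl_right

end Markov

/-! ## The cancellation `P(b ∈ C(S), y ∈ C(S)) − P(y ↔ b, y ∈ C(S)) = P(y | b)` -/

section Cancellation

variable {V : Type*} {E : Type*}

/-- `{y, b ∈ C(S), y ↮ b}` — "`y | b`": both in `C(S)`, in different clusters. -/
def splitClusterSetEvent (ends : E → Sym2 V) (S : Finset V) (y b : V) : Set (Config E) :=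
  memClusterSetEvent ends S y ∩ memClusterSetEvent ends S b ∩ (connEvent ends y b)ᶜ

/-- `{b ∈ C(S), y ∈ C(S)} = {y ∈ C(S), y ↔ b} ∪ {y | b}` (a disjoint union). -/
lemma memClusterSetEvent_inter_eq_union (ends : E → Sym2 V) (S : Finset V) (y b : V) :
    memClusterSetEvent ends S b ∩ memClusterSetEvent ends S y =
      memClusterSetEvent ends S y ∩ connEvent ends y b ∪ splitClusterSetEvent ends S y b := by
  ext ω
  simp only [splitClusterSetEvent, Set.mem_inter_iff, Set.mem_union, Set.mem_compl_iff,
    mem_connEvent, memClusterSetEvent, Set.mem_setOf_eq]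
  constructor
  · rintro ⟨hb, hy⟩
    by_cases h : Conn ends ω y b
    · exact Or.inl ⟨hy, h⟩
    · exact Or.inr ⟨⟨hy, hb⟩, h⟩
  · rintro (⟨hy, h⟩ | ⟨⟨hy, hb⟩, _⟩)
    · exact ⟨mem_clusterSet_of_conn hy h, hy⟩
    · exact ⟨hb, hy⟩

/-- The two parts of the cancellation are disjoint. -/
lemma disjoint_memClusterSet_conn_split (ends : E → Sym2 V) (S : Finset V) (y b : V) :
    Disjoint (memClusterSetEvent ends S y ∩ connEvent ends y b)
      (splitClusterSetEvent ends S y b) :=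
  Set.disjoint_left.2 fun _ ⟨_, h⟩ ⟨_, h'⟩ => h' h

variable [Fintype E] [DecidableEq E] {R : Type*} [CommRing R]

/-- **The cancellation**: `P(b ∈ C(S), y ∈ C(S)) − P(y ↔ b, y ∈ C(S)) = P(y | b)`. -/
theorem prob_memClusterSet_sub_eq_split (p : E → R) (ends : E → Sym2 V) (S : Finset V)
    (y b : V) :
    prob p (memClusterSetEvent ends S b ∩ memClusterSetEvent ends S y) -
        prob p (memClusterSetEvent ends S y ∩ connEvent ends y b) =
      prob p (splitClusterSetEvent ends S y b) := by
  rw [memClusterSetEvent_inter_eq_union,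
    prob_union_of_disjoint p (disjoint_memClusterSet_conn_split ends S y b)]
  ring

end Cancellation

end Summit.Ventures.PercRepro2
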